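import Literature.NumberTheory.Automorphic.ResGLnCuspidalCohomologyApex
import Literature.NumberTheory.Automorphic.ResGLnKugaPairedPrimitive
import Literature.NumberTheory.Automorphic.ResGLnRankZeroCochain
import HarnessLib

/-!
# Borel's injectivity of cuspidal cohomology in the cone model, reduced to the existence of a
# horizontal primitive of moderate growth

Topic `NumberTheory/Automorphic`; namespace `Literature.NumberTheory.Automorphic.ConeDictionary`.
Theorems only; no definition, no named fact, no `sorry`.

The named fact `Borel1983_coneClass_ne_zero` (`ResGLnCuspidalCohomologyApex`) asserts: for a clean
cuspidal `π` of `GL_n(𝔸_K)`, a basic, level-fixed cocycle `η ∈ Z^{q+1}(𝔤, K_∞; W ⊗ E_λ)` which is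
not a coboundary has NON-ZERO cone class `[ω_η] ∈ H^{q+1}(GL_n(K)^{tot.pos}; Coind E_λ)`.  Borel's
proof (Borel 1981 II 5.3/5.5, Borel 1983 Thm. 3.4, Borel–Wallach VII §2, XIV 2.3) has a `K_∞`-side —
Kuga's lemma, Wigner's lemma, the Casimir scalars, the energy argument — all of which is now in the
tree (`ResGLnKugaCasimirScalarE.coclosed_of_cuspidal`,
`ResGLnKugaPairedPrimitive.false_of_horizontal_pairedPrimitive`), and an analytic side on `Γ \ X⁺`:
de Rham's theorem with local coefficients and the regularization `A_umg ≃ A`, which turn the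
vanishing of the class into a PRIMITIVE of `η` of moderate growth.

* **`coneClass_ne_zero_of_primitive`** — the fact's conclusion `[ω_η] ≠ 0`, for `n ≠ 0`, from the
  single remaining analytic input stated for the given `η`: IF `[ω_η] = 0` then, for some auxiliary
  Lie module `W'` paired with the cusp forms `W` as in `false_of_horizontal_pairedPrimitive`
  (Petersson-extending, skew along the trace-zero Hermitian `x i`), there is a
  `(𝔨 ⊕ ℝ·1)`-horizontal `Ψ ∈ C^q(𝔤; W' ⊗ E_λ)` with `dΨ = (jW ⊗ 1) ∘ η`;
* `coneClass_ne_zero_rank_zero` — for `n = 0` the conclusion holds outright (the hypothesis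
  `η ∉ B` is void, `ResGLnRankZeroCochain`).

[cite: BorelWallach2000, VII 2.2–2.7, XIV 2.3] [cite: Borel1983Regularization, Thm. 3.2, 3.4]

## References

* A. Borel, N. Wallach (2000), VII §2, XIV 2.3 (held). [BorelWallach2000]
* A. Borel, *Regularization theorems in Lie algebra cohomology. Applications*, Duke Math. J. 50
  (1983), Thm. 3.2, 3.4. [Borel1983Regularization]
-/

noncomputable section

namespace Literature.NumberTheory.Automorphic

-- Mathlib idiom (as in `GKModules`): commutator bracket on matrix algebras and `Module.End`
attribute [local instance 100] LieRing.ofAssociativeRing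

open scoped TensorProduct Classical _root_.Matrix
open _root_.NumberField _root_.NumberField.InfinitePlace _root_.NumberField.mixedEmbedding IsDedekindDomain
open _root_.MeasureTheory Literature.Algebra.Lie.ChevalleyEilenberg

namespace ConeDictionary

open ResGLnCohomology BigHeckeGLn Literature.NumberTheory.DiophantineGeometry

variable {n : ℕ} {K : Type} [Field K] [NumberField K] {hcpt : isCompact_glFiniteIntegralLevel n K}

/-- **Borel's injectivity, reduced to the existence of a horizontal moderate-growth primitive**
(`n ≠ 0`).  Let `π` be a clean cuspidal automorphic representation of `GL_n(𝔸_K)`,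
`η ∈ Z^{q+1}(𝔤, K_∞; W ⊗ E_λ)` basic (`i_Z η = 0`) and not a coboundary, with cone forms `ω_η`
(`hω`).  Suppose given an automorphic measure `μ`, a unitary twist `T`, an auxiliary complex Lie
module `W'` of `𝔤` with a sesquilinear pairing `p : W' × W → ℂ` extending the Petersson form
`T.pet μ` along a linear `jW : W → W'` and skew along the `x i`, such that the VANISHING of the cone
class `[ω_η] ∈ H^{q+1}(GL_n(K)^{tot.pos}; Coind E_λ)` produces a `(𝔨 ⊕ ℝ·1)`-horizontal
`Ψ ∈ C^q(𝔤; W' ⊗ E_λ)` with `dΨ = (jW ⊗ 1) ∘ η` (de Rham on `Γ \ X⁺` with local coefficients plus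
Borel's regularization `A_umg ≃ A` — the analytic half of Borel's theorem).  Then `[ω_η] ≠ 0`.
[cite: BorelWallach2000, VII 2.2–2.7, XIV 2.3] [cite: Borel1983Regularization, Thm. 3.2, 3.4] -/
theorem coneClass_ne_zero_of_primitive [NeZero n] (𝔫 : Ideal (𝓞 K)) (π : CuspidalAutomorphicRepData n K hcpt)
    (hW' : π.1.W' = ⊥) (S : Finset {w : InfinitePlace K // w.IsReal}) (lam : (K →+* ℂ) → Fin n → ℤ)
    (q : ℕ) (η : Cochain π.1 lam (q + 1)) (hZ : η ∈ (gkComplexLS π.1 S lam).cocycles (q + 1))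
    (hins : ins q (⟨1, trivial⟩ : (AutomorphyDatum.gl n K hcpt).arch.lie) η = 0)
    (hB : η ∉ (gkComplexLS π.1 S lam).coboundaries (q + 1))
    (hω : TwistedQuotient.IsConeFormFamily (diagPos n K) (level n K 𝔫) (coeffRepPos ℂ n K lam)
      ((ResGLnCone.coneActionRat n K).comp (glTotPos n K).subtype) (ResGLnCone.posCone n K)
      (fun c H => coneForm π.1 S lam η c H))
    (μ : Measure (AdelicGroupData.gl n K).automorphicQuotient) [(AdelicGroupData.gl n K).IsAutomorphicMeasure μ]
    (T : π.1.UnitaryTwist) {W' : Type*} [AddCommGroup W'] [Module ℂ W']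
    (ρ' : (AutomorphyDatum.gl n K hcpt).arch.lie →ₗ⁅ℝ⁆ Module.End ℂ W') {p : W' → π.1.W → ℂ} (hp : Kuga.IsSesqPairing p)
    (hskew : ∀ (i : Fin (ResGLnCartan.pZeroDim n K)) (w' : W') (w : π.1.W),
      p (ρ' (xD n K hcpt i) w') w = -p w' (π.1.lieDerivW (xD n K hcpt i) w))
    {jW : π.1.W →ₗ[ℂ] W'} (hj : ∀ w w₂, p (jW w) w₂ = T.pet μ w w₂)
    (hex : TwistedQuotient.coneClass hω (ResGLnCone.hermOne_mem_posCone n K) = 0 →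
      ∃ Ψ : Literature.Algebra.Lie.ChevalleyEilenberg.Cochain ℝ (𝔤D n K hcpt) (Carrier' lam ρ') q,
        Ψ ∈ horizontal (M := Carrier' lam ρ') (kPrimeD n K hcpt) q ∧
          d ℝ (𝔤D n K hcpt) (Carrier' lam ρ') q Ψ = post (𝔤D n K hcpt) (inclT π.1 lam ρ' jW) (q + 1) η) :
    TwistedQuotient.coneClass hω (ResGLnCone.hermOne_mem_posCone n K) ≠ 0 := by
  intro h0
  obtain ⟨Ψ, hΨ, hprim⟩ := hex h0
  exact false_of_horizontal_pairedPrimitive lam π hW' S μ T ρ' hp hskew hj q hZ hB hins hΨ hprim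

/-- **The rank-zero corner**: for `n = 0` the conclusion of `Borel1983_coneClass_ne_zero` holds
outright, its hypothesis `η ∉ B^{q+1}` being void (`ResGLnRankZeroCochain`). [folklore] -/
theorem coneClass_ne_zero_rank_zero {hcpt : isCompact_glFiniteIntegralLevel 0 K} (𝔫 : Ideal (𝓞 K))
    (π : CuspidalAutomorphicRepData 0 K hcpt) (S : Finset {w : InfinitePlace K // w.IsReal})
    (lam : (K →+* ℂ) → Fin 0 → ℤ) (q : ℕ) (η : Cochain π.1 lam (q + 1))
    (hB : η ∉ (gkComplexLS π.1 S lam).coboundaries (q + 1))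
    (hω : TwistedQuotient.IsConeFormFamily (diagPos 0 K) (level 0 K 𝔫) (coeffRepPos ℂ 0 K lam)
      ((ResGLnCone.coneActionRat 0 K).comp (glTotPos 0 K).subtype) (ResGLnCone.posCone 0 K)
      (fun c H => coneForm π.1 S lam η c H)) :
    TwistedQuotient.coneClass hω (ResGLnCone.hermOne_mem_posCone 0 K) ≠ 0 :=
  fun _ => hB (mem_coboundaries_of_rank_zero π.1 S lam q η)

end ConeDictionary

end Literature.NumberTheory.Automorphic

end
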